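import Literature.Geometry.Kaehler.ComplexTorusTranscendentalLatticeAllDegrees
import Literature.Geometry.Kaehler.ComplexTorusTranscendentalLatticeHardLefschetz
import HarnessLib

/-!
# Biduality of the Hodge and transcendental lattices in every degree: `Hdg^{k,p}(X, ℤ) = (T^l)^⊥ ∩ Hᵏ(X, ℤ)` and
# `B^{k,p}(X) = (T^l)^⊥ ∩ Hᵏ(X, ℚ)`; `T^l = 0 ⟺ Hdg^{k,p}(X, ℤ) = Hᵏ(X, ℤ)`, `T^l = Hˡ(X, ℤ) ⟺ Hdg^{k,p}(X, ℤ) = 0`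

Layer `Literature/Geometry/Kaehler`, namespace `Literature.Geometry.Kaehler.ComplexTorus`; lane `lit-hodgefound` (Track 2
foundations library), seat p09, generation 32, row g32-#2. THEOREMS ONLY (0 definitions); no named fact, net debt 0. Sequel of
`ComplexTorusTranscendentalLatticeAllDegrees` (g31-#11): for a complex torus `X = E/Φ(ℤ^ι)`, an enumeration `e : Fin n ≃ ι`, complementary
degrees `h : k + l = n` and the cup-product pairing `⟨γ, δ⟩ = poincarePairing Φ e h γ δ` (perfect over `ℚ`: `poincarePairingRat_isPerfPair`),
the degree-`l` TRANSCENDENTAL LATTICE is the annihilator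

  `T := Hˡ(X, ℤ) ∩ ⋂_{s ∈ Hdg^{k,p}(X, ℤ)} ker ⟨s, ·⟩ = integralForms Φ l ⊓ ⨅_{s} (ker ⟨s, ·⟩).toAddSubgroup`

(written out, no definition; Huybrechts: "`T(X) = NS(X)^⊥`"). g31-#11 proved `rk T = C(2g, l) − rk Hdg^{k,p}(X, ℤ)` and `ℚ·T = (B^{k,p})^⊥ ∩ Hˡ(X, ℚ)`;
g31-#2 (`ComplexTorusMiddleTranscendentalLatticeHodgeTypes`, MIDDLE degree `k = l = g`, in the `BilinForm ℤ`-language of g30's Hodge sublattice)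
proved `Bᵖ(X) = T^⊥ ∩ H^{2p}(X, ℚ)` (`mem_hodgeClasses_iff_forall_mem_orthogonal`). THIS file proves the BIDUALITY in EVERY degree, in the
cup-pairing language of g31-#11:

* §1 over `ℚ`: **`B^{k,p}(X) = T^⊥ ∩ Hᵏ(X, ℚ)`** — a rational class `s` is a Hodge class iff `⟨s, x⟩ = 0` for every `x` in the (integral)
  transcendental lattice `T`. Proof: `⟨s, T⟩ = 0 ⟹ ⟨s, ℚ·T⟩ = 0` (denominators), `ℚ·T` is the dual co-annihilator of the image `W` of `B^{k,p}`
  of `B^{k,p}`; a rational class is in `B^{k,p}` iff it is killed by `(B^{k,p})^⊥ ⊆ Hᵏ(X, ℚ)^*` (Mathlib's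
  `Subspace.forall_mem_dualAnnihilator_apply_eq_zero_iff`), and every functional in `(B^{k,p})^⊥` is `⟨·, η⟩` with `η ∈ ℚ·T` (the Poincaré
  pairing is perfect over `ℚ`, `poincarePairingRat_isPerfPair`).
* §2 over `ℤ`: **`Hdg^{k,p}(X, ℤ) = T^⊥ ∩ Hᵏ(X, ℤ)`** (`Hdg^{k,p}(X, ℤ) = B^{k,p} ∩ Hᵏ(X, ℤ)`), as an equality of subgroups of `Hᵏ(X, ℂ)`:
  the Hodge lattice and the transcendental lattice are each other's annihilators (Huybrechts Ch. 3 §2.2–§3.3: for a projective K3 / abelian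
  surface "`NS(X) = T(X)^⊥`" and "`T(X) = NS(X)^⊥`").
* §3 the two extreme cases: **`T = 0 ⟺ Hdg^{k,p}(X, ℤ) = Hᵏ(X, ℤ)`** (all integral classes of degree `k` are Hodge — e.g. `k = 0`, `k = 2g`, or
  `p = 1` on `E_τ²` with `τ` imaginary quadratic, maximal Picard number) and **`T = Hˡ(X, ℤ) ⟺ Hdg^{k,p}(X, ℤ) = 0`** (no Hodge classes — e.g.
  `k ≠ 2p`, or the very general torus); both via §2 and the non-degeneracy of `⟨ , ⟩` tested on the lattice bases of `Hᵏ(X, ℤ)`, `Hˡ(X, ℤ)`.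
* §4 (OUTLOOK (b) of generation 31, wrappers of g31-#14's `finrank_integralHodgeAnnihilator_eq_of_hardLefschetz`): on a POLARIZED torus /
  abelian variety the transcendental lattices in the Lefschetz-dual degrees `2p` and `2g − 2p` have the same rank.

## Contents (theorems only)

* §1 `poincarePairing_eq_zero_of_forall_mem_integralHodgeAnnihilator` (`⟨s, T⟩ = 0 ⟹ ⟨s, ℚ·T⟩ = 0`),
  **`mem_hodgeClassesIn_iff_forall_poincarePairing_eq_zero`** (`B^{k,p} = T^⊥ ∩ Hᵏ(X, ℚ)`), `hodgeClassesIn_eq_rationalForms_inf_iInf_ker`.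
* §2 **`mem_integralHodgeClassesIn_iff_forall_poincarePairing_eq_zero`**, **`integralHodgeClassesIn_eq_integralForms_inf_iInf_ker`**
  (`Hdg^{k,p}(X, ℤ) = Hᵏ(X, ℤ) ⊓ ⨅_{x ∈ T} ker ⟨·, x⟩`).
* §3 `eq_zero_of_forall_mem_integralForms_poincarePairing_eq_zero` (left/right: a class orthogonal to the whole lattice vanishes),
  **`integralHodgeAnnihilator_eq_bot_iff`** (`T = 0 ⟺ Hdg^{k,p}(X, ℤ) = Hᵏ(X, ℤ)`), **`integralHodgeAnnihilator_eq_integralForms_iff`**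
  (`T = Hˡ(X, ℤ) ⟺ Hdg^{k,p}(X, ℤ) = 0`).
* §4 `IsRiemannForm.finrank_integralHodgeAnnihilator_eq_of_hardLefschetz`, `IsAbelianVariety.finrank_integralHodgeAnnihilator_eq_of_hardLefschetz`.

## References

* [cite: Huybrechts2016K3, Ch. 3 §2.2–2.3 (PDF pp. 58–59: `T(X) = NS(X)^⊥`, "transcendental lattice"; for projective `X`, `NS(X) = T(X)^⊥`); Ch. 14 §0.1 (PDF p. 333)]
* [cite: Lange2023AbelianVarietiesComplex, §6.2.4 (p. 310: Poincaré duality `Hᵖ(X, ℤ) ⥲ H^{2g−p}(X, ℤ)^*`); §7.2.2; §7.3.2 (1); §1.1.3 Exercise 1.1.6 (8)]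
* [cite: ShiodaMitani1974, §3 (3.19) (`T_X`, `T_X^⊥ = S_X`)]
* [cite: Ebeling1994, §1.1 before Prop. 1.2 (`K^⊥`; primitive sublattices and `K^{⊥⊥}`)]
-/

noncomputable section

open Module Function

namespace Literature.Geometry.Kaehler.ComplexTorus

section Biduality

variable {ι : Type*} [Fintype ι] [DecidableEq ι] {E : Type*} [NormedAddCommGroup E] [NormedSpace ℂ E]
  (Φ : (ι → ℝ) ≃L[ℝ] E) {n k l : ℕ} (e : Fin n ≃ ι) (h : k + l = n) (p : ℕ)

/-! ## §1 `B^{k,p}(X) = T^⊥ ∩ Hᵏ(X, ℚ)` -/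

/-- **`⟨s, T⟩ = 0 ⟹ ⟨s, ℚ·T⟩ = 0`**: a class orthogonal to the transcendental LATTICE is orthogonal to every RATIONAL class annihilated by
`Hdg^{k,p}(X, ℤ)` (such a class has a positive integral multiple in `T`, g31-#11's `exists_nsmul_mem_integralHodgeAnnihilator_of_mem_rationalForms`).
[cite: Lange2023AbelianVarietiesComplex, §1.1.3 Exercise 1.1.6 (8) and §7.2.2] -/
theorem poincarePairing_eq_zero_of_forall_mem_integralHodgeAnnihilator {s : E [⋀^Fin k]→L[ℝ] ℂ}
    (hs : ∀ x ∈ integralForms Φ l ⊓ ⨅ t : integralHodgeClassesIn Φ k p,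
        (LinearMap.ker (poincarePairing Φ e h (t : E [⋀^Fin k]→L[ℝ] ℂ))).toAddSubgroup, poincarePairing Φ e h s x = 0)
    {y : E [⋀^Fin l]→L[ℝ] ℂ} (hyQ : y ∈ rationalForms Φ l)
    (hy : ∀ t ∈ integralHodgeClassesIn Φ k p, poincarePairing Φ e h t y = 0) : poincarePairing Φ e h s y = 0 := by
  obtain ⟨N, hN, hNy⟩ := exists_nsmul_mem_integralHodgeAnnihilator_of_mem_rationalForms Φ e h p hyQ hy
  have h1 := hs _ hNy
  rw [LinearMap.map_smul, smul_eq_mul, mul_eq_zero] at h1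
  exact h1.resolve_left (by exact_mod_cast hN.ne')

/-- **Biduality over `ℚ`: `B^{k,p}(X) = T^⊥ ∩ Hᵏ(X, ℚ)`** — a rational class `s ∈ Hᵏ(X, ℚ)` is a Hodge class iff `⟨s, x⟩ = 0` for every
`x` in the transcendental lattice `T = Hdg^{k,p}(X, ℤ)^⊥ ∩ Hˡ(X, ℤ)` (`k + l = 2g`). (`⟹`: g31-#11. `⟸`: `s ∈ B^{k,p}` iff every
functional of `(B^{k,p})^⊥ ⊆ Hᵏ(X, ℚ)^*` kills `s`; by perfectness such a functional is `⟨·, η⟩` with `η ∈ ℚ·T`, and `⟨s, ℚ·T⟩ = 0`.)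
The middle-degree case in the `BilinForm ℤ` language is g31-#2's `mem_hodgeClasses_iff_forall_mem_orthogonal`.
[cite: Huybrechts2016K3, Ch. 3 §2.2–2.3 (PDF pp. 58–59)] [cite: Lange2023AbelianVarietiesComplex, §6.2.4 (p. 310) and §7.2.2] -/
theorem mem_hodgeClassesIn_iff_forall_poincarePairing_eq_zero {s : E [⋀^Fin k]→L[ℝ] ℂ} (hsQ : s ∈ rationalForms Φ k) :
    s ∈ hodgeClassesIn Φ k p ↔ ∀ x ∈ integralForms Φ l ⊓ ⨅ t : integralHodgeClassesIn Φ k p,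
        (LinearMap.ker (poincarePairing Φ e h (t : E [⋀^Fin k]→L[ℝ] ℂ))).toAddSubgroup, poincarePairing Φ e h s x = 0 := by
  refine ⟨fun hsB x hx ↦ poincarePairing_eq_zero_of_mem_hodgeClassesIn_of_mem_integralHodgeAnnihilator Φ e h p hx hsB, fun hs ↦ ?_⟩
  haveI := finiteDimensional_rationalForms Φ k
  haveI := finiteDimensional_rationalForms Φ l
  set U : Submodule ℚ (rationalForms Φ k) := (hodgeClassesIn Φ k p).comap (rationalForms Φ k).subtype with hU
  have hI : LinearMap.IsPerfPair (M := rationalForms Φ k) (N := rationalForms Φ l) (poincarePairingRat Φ e h) :=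
    inferInstance
  suffices hσ : (⟨s, hsQ⟩ : rationalForms Φ k) ∈ U by rw [hU, Submodule.mem_comap] at hσ; exact hσ
  -- `σ ∈ U ⟺ φ σ = 0` for every `φ ∈ U^⊥ ⊆ Hᵏ(X, ℚ)^*`; every such `φ` is `⟨·, η⟩` with `η ∈ ℚ·T` (perfect pairing)
  refine (Subspace.forall_mem_dualAnnihilator_apply_eq_zero_iff (K := ℚ) (V := ↥(rationalForms Φ k)) U ⟨s, hsQ⟩).1
    fun φ hφ ↦ ?_
  obtain ⟨η, rfl⟩ := hI.bijective_right.2 φ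
  rw [Submodule.mem_dualAnnihilator] at hφ
  have hηA : ∀ t ∈ integralHodgeClassesIn Φ k p, poincarePairing Φ e h t (η : E [⋀^Fin l]→L[ℝ] ℂ) = 0 := by
    intro t ht
    have htQ : t ∈ rationalForms Φ k := (integralHodgeClassesIn_subset_hodgeClassesIn Φ k p ht).1
    have h1 := hφ ⟨t, htQ⟩
      (show (⟨t, htQ⟩ : rationalForms Φ k) ∈ U from integralHodgeClassesIn_subset_hodgeClassesIn Φ k p ht)
    rw [LinearMap.flip_apply] at h1
    have h2 := congrArg (fun q : ℚ ↦ (q : ℂ)) h1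
    simpa only [coe_poincarePairingRat, Rat.cast_zero] using h2
  have h3 : poincarePairing Φ e h s (η : E [⋀^Fin l]→L[ℝ] ℂ) = 0 :=
    poincarePairing_eq_zero_of_forall_mem_integralHodgeAnnihilator Φ e h p hs η.2 hηA
  have h4 : ((poincarePairingRat Φ e h ⟨s, hsQ⟩ η : ℚ) : ℂ) = 0 := by rw [coe_poincarePairingRat]; exact h3
  rw [LinearMap.flip_apply]
  exact_mod_cast h4

/-- **`B^{k,p}(X) = Hᵏ(X, ℚ) ⊓ ⨅_{x ∈ T} ker ⟨·, x⟩`** as an equality of `ℚ`-submodules of `Hᵏ(X, ℂ)`.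
[cite: Huybrechts2016K3, Ch. 3 §2.2–2.3 (PDF pp. 58–59)] [cite: Lange2023AbelianVarietiesComplex, §7.2.2] -/
theorem hodgeClassesIn_eq_rationalForms_inf_iInf_ker :
    hodgeClassesIn Φ k p = rationalForms Φ k ⊓ ⨅ x : ↥(integralForms Φ l ⊓ ⨅ t : integralHodgeClassesIn Φ k p,
        (LinearMap.ker (poincarePairing Φ e h (t : E [⋀^Fin k]→L[ℝ] ℂ))).toAddSubgroup),
      (LinearMap.ker ((poincarePairing Φ e h).flip (x : E [⋀^Fin l]→L[ℝ] ℂ))).restrictScalars ℚ := by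
  ext s
  rw [Submodule.mem_inf, Submodule.mem_iInf]
  constructor
  · intro hsB
    refine ⟨hsB.1, fun x ↦ ?_⟩
    rw [Submodule.restrictScalars_mem, LinearMap.mem_ker, LinearMap.flip_apply]
    exact (mem_hodgeClassesIn_iff_forall_poincarePairing_eq_zero Φ e h p hsB.1).1 hsB x x.2
  · rintro ⟨hsQ, hs⟩
    refine (mem_hodgeClassesIn_iff_forall_poincarePairing_eq_zero Φ e h p hsQ).2 fun x hx ↦ ?_
    have h1 := hs ⟨x, hx⟩
    rwa [Submodule.restrictScalars_mem, LinearMap.mem_ker, LinearMap.flip_apply] at h1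

/-! ## §2 `Hdg^{k,p}(X, ℤ) = T^⊥ ∩ Hᵏ(X, ℤ)` -/

/-- **Biduality over `ℤ`: `Hdg^{k,p}(X, ℤ) = T^⊥ ∩ Hᵏ(X, ℤ)`** — an integral class `s ∈ Hᵏ(X, ℤ)` is a Hodge class iff `⟨s, x⟩ = 0`
for every `x ∈ T`, the transcendental lattice being itself `T = Hdg^{k,p}(X, ℤ)^⊥ ∩ Hˡ(X, ℤ)`: the Hodge lattice and the transcendental
lattice are each other's annihilators under the cup product `Hᵏ(X, ℤ) × Hˡ(X, ℤ) → ℤ` (`Hdg^{k,p}(X, ℤ) = B^{k,p} ∩ Hᵏ(X, ℤ)`, §1).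
[cite: Huybrechts2016K3, Ch. 3 §2.2–2.3 (PDF pp. 58–59) and §3.3] [cite: ShiodaMitani1974, §3 (3.19)] -/
theorem mem_integralHodgeClassesIn_iff_forall_poincarePairing_eq_zero {s : E [⋀^Fin k]→L[ℝ] ℂ} (hsZ : s ∈ integralForms Φ k) :
    s ∈ integralHodgeClassesIn Φ k p ↔ ∀ x ∈ integralForms Φ l ⊓ ⨅ t : integralHodgeClassesIn Φ k p,
        (LinearMap.ker (poincarePairing Φ e h (t : E [⋀^Fin k]→L[ℝ] ℂ))).toAddSubgroup, poincarePairing Φ e h s x = 0 := by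
  rw [mem_integralHodgeClassesIn_iff_mem_hodgeClassesIn,
    mem_hodgeClassesIn_iff_forall_poincarePairing_eq_zero Φ e h p (mem_rationalForms_of_mem_integralForms Φ hsZ)]
  exact ⟨fun hs ↦ hs.1, fun hs ↦ ⟨hs, hsZ⟩⟩

/-- **`Hdg^{k,p}(X, ℤ) = Hᵏ(X, ℤ) ⊓ ⨅_{x ∈ T} ker ⟨·, x⟩`**, `T = Hˡ(X, ℤ) ⊓ ⨅_{s ∈ Hdg^{k,p}(X, ℤ)} ker ⟨s, ·⟩`: the double annihilator
of the Hodge lattice is the Hodge lattice. [cite: Huybrechts2016K3, Ch. 3 §2.2–2.3 (PDF pp. 58–59); Ch. 14 §0.1 (PDF p. 333)] [cite: Ebeling1994, §1.1 before Prop. 1.2] -/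
theorem integralHodgeClassesIn_eq_integralForms_inf_iInf_ker :
    integralHodgeClassesIn Φ k p = integralForms Φ k ⊓ ⨅ x : ↥(integralForms Φ l ⊓ ⨅ t : integralHodgeClassesIn Φ k p,
        (LinearMap.ker (poincarePairing Φ e h (t : E [⋀^Fin k]→L[ℝ] ℂ))).toAddSubgroup),
      (LinearMap.ker ((poincarePairing Φ e h).flip (x : E [⋀^Fin l]→L[ℝ] ℂ))).toAddSubgroup := by
  ext s
  rw [AddSubgroup.mem_inf, AddSubgroup.mem_iInf]
  constructor
  · intro hsH
    refine ⟨hsH.1, fun x ↦ ?_⟩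
    rw [Submodule.mem_toAddSubgroup, LinearMap.mem_ker, LinearMap.flip_apply]
    exact (mem_integralHodgeClassesIn_iff_forall_poincarePairing_eq_zero Φ e h p hsH.1).1 hsH x x.2
  · rintro ⟨hsZ, hs⟩
    refine (mem_integralHodgeClassesIn_iff_forall_poincarePairing_eq_zero Φ e h p hsZ).2 fun x hx ↦ ?_
    have h1 := hs ⟨x, hx⟩
    rwa [Submodule.mem_toAddSubgroup, LinearMap.mem_ker, LinearMap.flip_apply] at h1

/-! ## §3 The extreme cases `T = 0` and `T = Hˡ(X, ℤ)` -/

/-- A class of degree `l` orthogonal to the whole lattice `Hᵏ(X, ℤ)` vanishes (the lattice monomials `dx_w` are integral and form a `ℂ`-basis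
of `Hᵏ(X, ℂ)`; the pairing is non-degenerate). [cite: Lange2023AbelianVarietiesComplex, §1.1.3 Cor. 1.1.19 / Exercise 1.1.6 (7) and §6.2.4 (p. 310)] -/
theorem eq_zero_of_forall_mem_integralForms_poincarePairing_eq_zero {x : E [⋀^Fin l]→L[ℝ] ℂ}
    (hx : ∀ s ∈ integralForms Φ k, poincarePairing Φ e h s x = 0) : x = 0 := by
  classical
  letI : LinearOrder ι := LinearOrder.lift' (Fintype.equivFin ι) (Fintype.equivFin ι).injective
  have hL : (poincarePairing Φ e h).flip x = 0 := (latMonomialBasis Φ k).ext fun w ↦ by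
    rw [latMonomialBasis_apply, LinearMap.flip_apply, LinearMap.zero_apply]
    exact hx _ (latMonomial_mem_integralForms Φ k w.1)
  refine eq_zero_of_forall_left_poincarePairing_eq_zero Φ e h fun γ ↦ ?_
  have h1 := LinearMap.congr_fun hL γ
  rwa [LinearMap.flip_apply, LinearMap.zero_apply] at h1

/-- A class of degree `k` orthogonal to the whole lattice `Hˡ(X, ℤ)` vanishes. [cite: Lange2023AbelianVarietiesComplex, §1.1.3 Cor. 1.1.19 / Exercise 1.1.6 (7) and §6.2.4 (p. 310)] -/
theorem eq_zero_of_forall_mem_integralForms_poincarePairing_eq_zero' {s : E [⋀^Fin k]→L[ℝ] ℂ}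
    (hs : ∀ x ∈ integralForms Φ l, poincarePairing Φ e h s x = 0) : s = 0 := by
  classical
  letI : LinearOrder ι := LinearOrder.lift' (Fintype.equivFin ι) (Fintype.equivFin ι).injective
  have hL : poincarePairing Φ e h s = 0 := (latMonomialBasis Φ l).ext fun w ↦ by
    rw [latMonomialBasis_apply, LinearMap.zero_apply]
    exact hs _ (latMonomial_mem_integralForms Φ l w.1)
  refine eq_zero_of_forall_right_poincarePairing_eq_zero Φ e h fun δ ↦ ?_
  rw [hL, LinearMap.zero_apply]

/-- **`T = 0 ⟺ Hdg^{k,p}(X, ℤ) = Hᵏ(X, ℤ)`**: the transcendental lattice vanishes iff every integral class of degree `k` is a Hodge class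
(e.g. `k = 0`, `k = 2g`; `k = 2`, `p = 1` on `E_τ × E_τ` with `τ` imaginary quadratic — maximal Picard number). (`⟹`: biduality §2;
`⟸`: a class orthogonal to all of `Hᵏ(X, ℤ)` is zero.) [cite: Huybrechts2016K3, Ch. 3 §2.3 (PDF p. 59) and Ch. 14 §0.1] [cite: ShiodaMitani1974, §3 (3.19) and §4] -/
theorem integralHodgeAnnihilator_eq_bot_iff :
    integralForms Φ l ⊓ ⨅ t : integralHodgeClassesIn Φ k p,
        (LinearMap.ker (poincarePairing Φ e h (t : E [⋀^Fin k]→L[ℝ] ℂ))).toAddSubgroup = ⊥ ↔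
      integralHodgeClassesIn Φ k p = integralForms Φ k := by
  constructor
  · intro hT
    refine le_antisymm (fun s hs ↦ hs.1) fun s hsZ ↦ ?_
    refine (mem_integralHodgeClassesIn_iff_forall_poincarePairing_eq_zero Φ e h p hsZ).2 fun x hx ↦ ?_
    rw [hT, AddSubgroup.mem_bot] at hx
    rw [hx, map_zero]
  · intro hH
    rw [eq_bot_iff]
    intro x hx
    rw [mem_integralHodgeAnnihilator_iff, hH] at hx
    rw [AddSubgroup.mem_bot]
    exact eq_zero_of_forall_mem_integralForms_poincarePairing_eq_zero Φ e h hx.2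

/-- **`T = Hˡ(X, ℤ) ⟺ Hdg^{k,p}(X, ℤ) = 0`**: the transcendental lattice is the whole lattice iff there are no non-zero integral Hodge classes of
bidegree `(k, p)` (e.g. `k ≠ 2p`, g31-#13's `integralHodgeAnnihilator_eq_integralForms_of_ne`; the very general torus for `0 < p < g`).
(`⟹`: a Hodge class is orthogonal to `T = Hˡ(X, ℤ)`, hence zero; `⟸`: definition.) [cite: Huybrechts2016K3, Ch. 3 §2.2–2.3 (PDF pp. 58–59)] [cite: Lange2023AbelianVarietiesComplex, §7.2.2] -/
theorem integralHodgeAnnihilator_eq_integralForms_iff :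
    integralForms Φ l ⊓ ⨅ t : integralHodgeClassesIn Φ k p,
        (LinearMap.ker (poincarePairing Φ e h (t : E [⋀^Fin k]→L[ℝ] ℂ))).toAddSubgroup = integralForms Φ l ↔
      integralHodgeClassesIn Φ k p = ⊥ := by
  constructor
  · intro hT
    rw [eq_bot_iff]
    intro s hs
    rw [AddSubgroup.mem_bot]
    refine eq_zero_of_forall_mem_integralForms_poincarePairing_eq_zero' Φ e h fun x hx ↦ ?_
    have hxT : x ∈ integralForms Φ l ⊓ ⨅ t : integralHodgeClassesIn Φ k p,
        (LinearMap.ker (poincarePairing Φ e h (t : E [⋀^Fin k]→L[ℝ] ℂ))).toAddSubgroup := by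
      rw [hT]; exact hx
    exact poincarePairing_eq_zero_of_mem_hodgeClassesIn_of_mem_integralHodgeAnnihilator Φ e h p hxT
      (integralHodgeClassesIn_subset_hodgeClassesIn Φ k p hs)
  · intro hH
    refine le_antisymm inf_le_left fun x hx ↦ (mem_integralHodgeAnnihilator_iff Φ e h p).2 ⟨hx, fun s hs ↦ ?_⟩
    rw [hH, AddSubgroup.mem_bot] at hs
    rw [hs, map_zero, LinearMap.zero_apply]

/-! ## §4 Lefschetz-dual degrees on a polarized torus (OUTLOOK (b) of generation 31) -/

/-- **`rk (Hdg^{j+p})^⊥_{H^{2p}(X, ℤ)} = rk (Hdgᵖ)^⊥_{H^{2j+2p}(X, ℤ)}` on a POLARIZED torus** (`2p + j = g`): the transcendental lattices in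
the Lefschetz-dual degrees `2p` and `2g − 2p` have the same rank (g31-#14's `finrank_integralHodgeAnnihilator_eq_of_hardLefschetz`, a Riemann
form being a non-degenerate `NS`-class). [cite: Lange2023AbelianVarietiesComplex, §7.3.2 (1) and §1.1.3 Exercise 1.1.6 (8)] -/
theorem IsRiemannForm.finrank_integralHodgeAnnihilator_eq_of_hardLefschetz [FiniteDimensional ℂ E] {η : E [⋀^Fin 2]→L[ℝ] ℝ}
    (hη : IsRiemannForm Φ η) {p j : ℕ} (hpj : 2 * p + j = finrank ℂ E) (h : 2 * j + 2 * p + 2 * p = n)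
    (h' : 2 * p + (2 * j + 2 * p) = n) :
    finrank ℤ ↥(integralForms Φ (2 * p) ⊓ ⨅ s : integralHodgeClassesIn Φ (2 * j + 2 * p) (j + p),
        (LinearMap.ker (poincarePairing Φ e h (s : E [⋀^Fin (2 * j + 2 * p)]→L[ℝ] ℂ))).toAddSubgroup) =
      finrank ℤ ↥(integralForms Φ (2 * j + 2 * p) ⊓ ⨅ s : integralHodgeClassesIn Φ (2 * p) p,
        (LinearMap.ker (poincarePairing Φ e h' (s : E [⋀^Fin (2 * p)]→L[ℝ] ℂ))).toAddSubgroup) :=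
  ComplexTorus.finrank_integralHodgeAnnihilator_eq_of_hardLefschetz Φ e hη.isNSForm (IsRiemannForm.exists_apply_ne_zero Φ hη) hpj h h'

/-- **On an abelian variety the transcendental lattices in the Lefschetz-dual degrees `2p` and `2g − 2p` have the same rank.**
[cite: Lange2023AbelianVarietiesComplex, §7.3.2 (1) and §4.1] -/
theorem IsAbelianVariety.finrank_integralHodgeAnnihilator_eq_of_hardLefschetz [FiniteDimensional ℂ E] (hX : IsAbelianVariety Φ)
    {p j : ℕ} (hpj : 2 * p + j = finrank ℂ E) (h : 2 * j + 2 * p + 2 * p = n) (h' : 2 * p + (2 * j + 2 * p) = n) :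
    finrank ℤ ↥(integralForms Φ (2 * p) ⊓ ⨅ s : integralHodgeClassesIn Φ (2 * j + 2 * p) (j + p),
        (LinearMap.ker (poincarePairing Φ e h (s : E [⋀^Fin (2 * j + 2 * p)]→L[ℝ] ℂ))).toAddSubgroup) =
      finrank ℤ ↥(integralForms Φ (2 * j + 2 * p) ⊓ ⨅ s : integralHodgeClassesIn Φ (2 * p) p,
        (LinearMap.ker (poincarePairing Φ e h' (s : E [⋀^Fin (2 * p)]→L[ℝ] ℂ))).toAddSubgroup) := by
  obtain ⟨η, hη⟩ := hX
  exact hη.finrank_integralHodgeAnnihilator_eq_of_hardLefschetz Φ e hpj h h'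

end Biduality

end Literature.Geometry.Kaehler.ComplexTorus
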